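import Literature.Topology.FourManifolds.NovikovAdditivityPieces
import Literature.AlgebraicTopology.FundamentalGroup.DeformationRetractInclusion
import Literature.AlgebraicTopology.FundamentalGroup.VanKampenDeformation
import Literature.AlgebraicTopology.FundamentalGroup.CircleAndTorus
import Literature.AlgebraicTopology.FundamentalGroup.SphereSimplyConnected
import HarnessLib

/-!
# Seifert–van Kampen for a closed manifold glued from two pieces along a connected boundary

Topic `Literature/Topology/FourManifolds` (boundary gluings `P = M ∪_φ N`,
`BoundaryGluingData.lean`; thickenings of the pieces, `BoundaryGluingRelHomology.lean`,
`NovikovAdditivityPieces.lean`).  Written for step (b) "`π₁(X₁(m)) = 1`" of the proof of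
Lemma 8 of A. Akhmedov, B. D. Park, Invent. Math. 181 (2010) 577–603 (the Seiberg–Witten leaf
`Literature.Barriers.SmoothPoincare4.akhmedovPark2010_lemma8_invariants`): "From Seifert–Van
Kampen theorem, we can deduce that `π₁(X₁(m))` is a quotient of
`π₁(Y₁(1,1) ∖ νΣ₂) ∗ π₁(Z''(1,m) ∖ νΣ̄₂) / ⟨…⟩`", the normal connected sum being a gluing of the
two tube complements along `Σ₂ × S¹`.  The tree's van Kampen theorems
(`Literature/AlgebraicTopology/FundamentalGroup/VanKampen*.lean`) are stated for OPEN covers;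
here the two pieces are CLOSED (`jA M`, `jB N`) and one passes through the open thickenings
`A₁ = jA M ∪ jB(C₁)`, `B₁ = jB N ∪ jA(C₁)` by collar neighbourhoods, which deformation retract
onto the pieces (`BoundaryGluingData.exists_deformation_thickening`; Hatcher, *Algebraic
Topology* (2002), §1.2, the passage before Example 1.21 and the proof of Prop. 1.26).
Everything is PROVED; no definitions, no named facts:

* `BoundaryGluingData.closure_range_map_jA_jB_eq_top` — **`π₁(P, x₀)` is generated by the
  images of `π₁(M, a₀)` and `π₁(N, b₀)`** (`x₀ = jA a₀ = jB b₀` a seam point) when `M`, `N` and the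
  boundary `∂M ≅ S` are path connected (Hatcher Lemma 1.15, the tree's
  `closure_range_inclHom_union_eq_top`, on the thickenings; Prop. 1.17,
  `bijective_inclHomOfSubset_of_isStrongDeformationRetractOf`, to come back to the pieces;
  Prop. 1.18, `fundamentalGroupEquivOfHomeomorph`, to pass from `jA M` to `M`).
* `BoundaryGluingData.simplyConnectedSpace_of_normalClosure_eq_top` — **killing form**: if
  `π₁(M, a₀)`, `π₁(N, b₀)` are the normal closures of sets of loops which become trivial in `P`,
  then `P` is simply connected (the form used by Akhmedov–Park: the complements are "normally
  generated" by loops killed by the relations).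
* `BoundaryGluingData.simplyConnectedSpace` — in particular **a gluing of two simply connected
  pieces along a connected boundary is simply connected**.

## References

* A. Hatcher, *Algebraic Topology*, CUP 2002, §1.2: Lemma 1.15, Props. 1.17, 1.18, Thm. 1.20,
  and the passage before Example 1.21. [HatcherAT2002]
* A. Akhmedov, B. D. Park, Invent. Math. 181 (2010) 577–603, §9, proof of Lemma 8.
  [AkhmedovPark2010]
-/

noncomputable section

open scoped Manifold ContDiff Topology unitInterval
open Set Function Topology
open Literature.AlgebraicTopology.FundamentalGroup
open Literature.AlgebraicTopology.FundamentalGroup.VanKampen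
open Literature.AlgebraicTopology.Homotopy

namespace Literature.Topology.FourManifolds

namespace BoundaryGluingData

variable {m : ℕ}
variable {S : Type} [TopologicalSpace S] [ChartedSpace (EuclideanSpace ℝ (Fin (m + 1))) S]
  [IsManifold (𝓡 (m + 1)) ∞ S]
variable {S' : Type} [TopologicalSpace S'] [ChartedSpace (EuclideanSpace ℝ (Fin (m + 1))) S']
  [IsManifold (𝓡 (m + 1)) ∞ S']
variable {cM : NullCobordism (m + 1) S} {cN : NullCobordism (m + 1) S'} {φ : S ≃ S'}
variable {P : Type} [TopologicalSpace P] [ChartedSpace (EuclideanSpace ℝ (Fin (m + 1 + 1))) P]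
  [IsManifold (𝓡 (m + 1 + 1)) ∞ P]
variable (G : BoundaryGluingData cM.boundaryData cN.boundaryData φ P)

/-! ### Collar neighbourhoods are path connected -/

omit G in
/-- The collar neighbourhood `C₁ = κ(∂W × [0, 1))` of a path connected boundary is path
connected. [folklore] -/
theorem _root_.Literature.Topology.FourManifolds.NullCobordism.isPathConnected_collarNhd_one
    [PathConnectedSpace S'] (c : NullCobordism (m + 1) S') (κ : c.boundaryData.Collar) :
    IsPathConnected (c.collarNhd κ 1) := by
  rw [NullCobordism.collarNhd_def]
  refine IsPathConnected.image ?_ κ.continuous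
  -- `{p | p.2 < 1} = univ ×ˢ {t | t < 1}`, and `{t ∈ [0,1] | t < 1}` is the image of `[0, 1)`
  have hI : IsPathConnected {t : Set.Icc (0 : ℝ) 1 | (t : ℝ) < 1} := by
    have heq : {t : Set.Icc (0 : ℝ) 1 | (t : ℝ) < 1} = Set.projIcc 0 1 zero_le_one '' Ico 0 1 := by
      ext t
      constructor
      · intro ht
        exact ⟨t, ⟨t.2.1, ht⟩, Set.projIcc_val zero_le_one t⟩
      · rintro ⟨s, hs, rfl⟩
        show ((Set.projIcc 0 1 zero_le_one s : Set.Icc (0 : ℝ) 1) : ℝ) < 1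
        rw [Set.projIcc_of_mem zero_le_one ⟨hs.1, hs.2.le⟩]
        exact hs.2
    rw [heq]
    exact ((convex_Ico (0 : ℝ) 1).isPathConnected ⟨0, le_refl _, zero_lt_one⟩).image
      continuous_projIcc
  have hset : {p : c.boundaryData.carrier × Set.Icc (0 : ℝ) 1 | (p.2 : ℝ) < 1} =
      (univ : Set c.boundaryData.carrier) ×ˢ {t : Set.Icc (0 : ℝ) 1 | (t : ℝ) < 1} := by
    ext p
    simp only [mem_setOf_eq, mem_prod, mem_univ, true_and]
  rw [hset]
  haveI : PathConnectedSpace c.boundaryData.carrier := ‹PathConnectedSpace S'›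
  exact isPathConnected_univ.prod hI

/-! ### `π₁(P)` is generated by the two pieces -/

omit [IsManifold (𝓡 (m + 1 + 1)) ∞ P] in
/-- The common base point: `jB (incl (φ z₀)) = jA (incl z₀)` (the seam identity, stated with the
boundary inclusions of the null-cobordisms). [folklore] -/
theorem jB_incl_eq_jA_incl (z₀ : S) : G.jB (cN.incl (φ z₀)) = G.jA (cM.incl z₀) :=
  (G.jA_incl z₀).symm

/-- **`π₁(M ∪_φ N)` is generated by the images of `π₁(M)` and `π₁(N)`** (Hatcher 2002,
Lemma 1.15 with §1.2, the passage before Example 1.21): let `P = M ∪_φ N` be a boundary gluing of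
compact manifolds with boundary with `M`, `N` path connected and the boundary `S ≅ ∂M` path
connected and nonempty; for `z₀ ∈ S` put `a₀ = incl z₀`, `b₀ = incl (φ z₀)`, `x₀ = jA a₀ = jB b₀`.
Then the subgroup of `π₁(P, x₀)` generated by `jA_* π₁(M, a₀) ∪ jB_* π₁(N, b₀)` is everything.
[cite: HatcherAT2002, Lemma 1.15, Prop. 1.17, Prop. 1.18] -/
theorem closure_range_map_jA_jB_eq_top [CompactSpace S] [T2Space S] [Nonempty S]
    [PathConnectedSpace S] [CompactSpace S'] [T2Space S'] [Nonempty S'] [PathConnectedSpace S']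
    [PathConnectedSpace cM.W] [PathConnectedSpace cN.W] (z₀ : S) :
    Subgroup.closure
      (range (FundamentalGroup.mapOfEq (⟨G.jA, G.continuous_jA⟩ : C(cM.W, P))
          (rfl : G.jA (cM.incl z₀) = G.jA (cM.incl z₀))) ∪
        range (FundamentalGroup.mapOfEq (⟨G.jB, G.continuous_jB⟩ : C(cN.W, P))
          (G.jB_incl_eq_jA_incl z₀))) = ⊤ := by
  -- collars and the open thickenings `U = jA M ∪ jB(C₁)`, `T = jB N ∪ jA(C₁)`
  obtain ⟨κN⟩ := BoundaryData.nonempty_collar_of_compactSpace m cN.W cN.boundaryData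
  obtain ⟨κM⟩ := BoundaryData.nonempty_collar_of_compactSpace m cM.W cM.boundaryData
  set x₀ : P := G.jA (cM.incl z₀) with hx₀
  have hx₀B : G.jB (cN.incl (φ z₀)) = x₀ := G.jB_incl_eq_jA_incl z₀
  set U : Set P := range G.jA ∪ G.jB '' cN.collarNhd κN 1 with hU
  set T : Set P := range G.jB ∪ G.jA '' cM.collarNhd κM 1 with hT
  have hUo : IsOpen U := G.isOpen_thickening κN one_pos le_rfl
  have hTo : IsOpen T := G.symm.isOpen_thickening κM one_pos le_rfl
  have hcov : U ∪ T = univ := by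
    apply eq_univ_of_univ_subset
    rw [← G.range_union]
    exact union_subset_union subset_union_left subset_union_left
  have hxA : x₀ ∈ range G.jA := mem_range_self _
  have hxB : x₀ ∈ range G.jB := ⟨_, hx₀B⟩
  have hxU : x₀ ∈ U := Or.inl hxA
  have hxT : x₀ ∈ T := Or.inl hxB
  -- the thickenings deformation retract onto the pieces, hence are path connected
  have hdefU : IsStrongDeformationRetractOf (range G.jA) U := by
    obtain ⟨H, h0, h1, hfix⟩ := G.exists_deformation_thickening κN one_pos
    exact ⟨H, h0, h1, hfix⟩
  have hdefT : IsStrongDeformationRetractOf (range G.jB) T := by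
    obtain ⟨H, h0, h1, hfix⟩ := G.symm.exists_deformation_thickening κM one_pos
    exact ⟨H, h0, h1, hfix⟩
  have hApc : IsPathConnected (range G.jA) := isPathConnected_range G.continuous_jA
  have hBpc : IsPathConnected (range G.jB) := isPathConnected_range G.continuous_jB
  have hUpc : IsPathConnected U :=
    hdefU.isPathConnected (by rwa [inter_eq_left.2 (subset_union_left : range G.jA ⊆ U)])
  have hTpc : IsPathConnected T :=
    hdefT.isPathConnected (by rwa [inter_eq_left.2 (subset_union_left : range G.jB ⊆ T)])
  -- `U ∩ T = jA(C₁) ∪ jB(C₁)` is path connected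
  have hCM : IsPathConnected (G.jA '' cM.collarNhd κM 1) :=
    (cM.isPathConnected_collarNhd_one κM).image G.continuous_jA
  have hCN : IsPathConnected (G.jB '' cN.collarNhd κN 1) :=
    (cN.isPathConnected_collarNhd_one κN).image G.continuous_jB
  have hx₀CM : x₀ ∈ G.jA '' cM.collarNhd κM 1 :=
    ⟨cM.incl z₀, cM.boundary_subset_collarNhd κM one_pos (cM.incl_mem_boundary z₀), rfl⟩
  have hx₀CN : x₀ ∈ G.jB '' cN.collarNhd κN 1 :=
    ⟨cN.incl (φ z₀), cN.boundary_subset_collarNhd κN one_pos (cN.incl_mem_boundary _), hx₀B⟩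
  have hmeet_eq : U ∩ T = G.jA '' cM.collarNhd κM 1 ∪ G.jB '' cN.collarNhd κN 1 := by
    apply Subset.antisymm
    · rintro p ⟨hpU, hpT⟩
      rcases hpT with hpB | hpCM
      · rcases hpU with hpA | hpCN
        · -- a seam point `jA (incl z) = jA (κM (z, 0))`
          left
          obtain ⟨a, rfl⟩ := hpA
          obtain ⟨z, rfl⟩ := (G.jA_mem_seam_iff a).1
            (by rw [← G.range_inter_range]; exact ⟨mem_range_self a, hpB⟩)
          exact ⟨_, cM.boundary_subset_collarNhd κM one_pos (cM.incl_mem_boundary z), rfl⟩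
        · exact Or.inr hpCN
      · exact Or.inl hpCM
    · rintro p (hp | hp)
      · exact ⟨Or.inl (image_subset_range _ _ hp), Or.inr hp⟩
      · exact ⟨Or.inr hp, Or.inl (image_subset_range _ _ hp)⟩
  have hmeet : IsPathConnected (U ∩ T) := by
    rw [hmeet_eq]
    exact hCM.union hCN ⟨x₀, hx₀CM, hx₀CN⟩
  -- Hatcher's Lemma 1.15 on the open cover
  have h115 := closure_range_inclHom_union_eq_top hUo hTo hcov hxU hxT hUpc hTpc hmeet
  -- the images of `π₁(U)`, `π₁(T)` are those of `π₁(jA M)`, `π₁(jB N)` (deformation retracts) ...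
  have hbijU := bijective_inclHomOfSubset_of_isStrongDeformationRetractOf hdefU
    (subset_union_left : range G.jA ⊆ U) hxA
  have hbijT := bijective_inclHomOfSubset_of_isStrongDeformationRetractOf hdefT
    (subset_union_left : range G.jB ⊆ T) hxB
  have hrU : range (inclHom U x₀ hxU) = range (inclHom (range G.jA) x₀ hxA) := by
    rw [← inclHom_comp_inclHomOfSubset (subset_union_left : range G.jA ⊆ U) hxA hxU,
      MonoidHom.coe_comp, range_comp, hbijU.2.range_eq, image_univ]
  have hrT : range (inclHom T x₀ hxT) = range (inclHom (range G.jB) x₀ hxB) := by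
    rw [← inclHom_comp_inclHomOfSubset (subset_union_left : range G.jB ⊆ T) hxB hxT,
      MonoidHom.coe_comp, range_comp, hbijT.2.range_eq, image_univ]
  -- ... which are those of `π₁(M)`, `π₁(N)` along the embeddings `jA`, `jB`
  let ηM : cM.W ≃ₜ ↥(range G.jA) := G.isSmoothEmbedding_jA.isEmbedding.toHomeomorph
  let ηN : cN.W ≃ₜ ↥(range G.jB) := G.isSmoothEmbedding_jB.isEmbedding.toHomeomorph
  have hηM : ηM (cM.incl z₀) = ⟨x₀, hxA⟩ := rfl
  have hηN : ηN (cN.incl (φ z₀)) = ⟨x₀, hxB⟩ := Subtype.ext hx₀B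
  have keyM : ∀ a, inclHom (range G.jA) x₀ hxA (fundamentalGroupEquivOfHomeomorph ηM hηM a) =
      FundamentalGroup.mapOfEq (⟨G.jA, G.continuous_jA⟩ : C(cM.W, P)) rfl a := by
    intro a
    rw [fundamentalGroupEquivOfHomeomorph_apply]
    induction a using PushoutData.ind_fromPath with
    | h γ =>
      rw [inclHom, FundamentalGroup.mapOfEq_apply, FundamentalGroup.mapOfEq_apply,
        FundamentalGroup.mapOfEq_apply]
      exact congrArg (fun p => FundamentalGroup.fromPath (Path.Homotopic.Quotient.mk p))
        (by ext t; rfl)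
  have keyN : ∀ b, inclHom (range G.jB) x₀ hxB (fundamentalGroupEquivOfHomeomorph ηN hηN b) =
      FundamentalGroup.mapOfEq (⟨G.jB, G.continuous_jB⟩ : C(cN.W, P)) hx₀B b := by
    intro b
    rw [fundamentalGroupEquivOfHomeomorph_apply]
    induction b using PushoutData.ind_fromPath with
    | h γ =>
      rw [inclHom, FundamentalGroup.mapOfEq_apply, FundamentalGroup.mapOfEq_apply,
        FundamentalGroup.mapOfEq_apply]
      exact congrArg (fun p => FundamentalGroup.fromPath (Path.Homotopic.Quotient.mk p))
        (by ext t; rfl)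
  have hrA : range (inclHom (range G.jA) x₀ hxA) =
      range (FundamentalGroup.mapOfEq (⟨G.jA, G.continuous_jA⟩ : C(cM.W, P))
        (rfl : G.jA (cM.incl z₀) = G.jA (cM.incl z₀))) := by
    ext g
    constructor
    · rintro ⟨a, rfl⟩
      obtain ⟨a', rfl⟩ := (fundamentalGroupEquivOfHomeomorph ηM hηM).surjective a
      exact ⟨a', (keyM a').symm⟩
    · rintro ⟨a, rfl⟩
      exact ⟨_, keyM a⟩
  have hrB : range (inclHom (range G.jB) x₀ hxB) =
      range (FundamentalGroup.mapOfEq (⟨G.jB, G.continuous_jB⟩ : C(cN.W, P)) hx₀B) := by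
    ext g
    constructor
    · rintro ⟨b, rfl⟩
      obtain ⟨b', rfl⟩ := (fundamentalGroupEquivOfHomeomorph ηN hηN).surjective b
      exact ⟨b', (keyN b').symm⟩
    · rintro ⟨b, rfl⟩
      exact ⟨_, keyN b⟩
  rw [hrU, hrT, hrA, hrB] at h115
  exact h115

/-! ### Killing form, and simply connected pieces -/

/-- **Van Kampen, killing form, for boundary gluings** (Akhmedov–Park 2010, proof of Lemma 8:
"`π₁(X₁(m))` is a quotient of `π₁(Y₁(1,1) ∖ νΣ₂) ∗ π₁(Z''(1,m) ∖ νΣ̄₂) / ⟨…⟩`" with both factors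
"normally generated" by loops killed by the relations).  With `P = M ∪_φ N`, `z₀`, `a₀`, `b₀`,
`x₀` as in `closure_range_map_jA_jB_eq_top`: if `π₁(M, a₀)` is the normal closure of a set `A`
and `π₁(N, b₀)` of a set `B` such that `jA_* a = 1` and `jB_* b = 1` in `π₁(P, x₀)` for all
`a ∈ A`, `b ∈ B`, then `P` is simply connected. [cite: HatcherAT2002, Lemma 1.15] [cite: AkhmedovPark2010, §9, proof of Lemma 8] -/
theorem simplyConnectedSpace_of_normalClosure_eq_top [CompactSpace S] [T2Space S] [Nonempty S]
    [PathConnectedSpace S] [CompactSpace S'] [T2Space S'] [Nonempty S'] [PathConnectedSpace S']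
    [PathConnectedSpace cM.W] [PathConnectedSpace cN.W] (z₀ : S)
    {A : Set (FundamentalGroup cM.W (cM.incl z₀))}
    {B : Set (FundamentalGroup cN.W (cN.incl (φ z₀)))}
    (hA : Subgroup.normalClosure A = ⊤) (hB : Subgroup.normalClosure B = ⊤)
    (hA₁ : ∀ a ∈ A, FundamentalGroup.mapOfEq (⟨G.jA, G.continuous_jA⟩ : C(cM.W, P))
      (rfl : G.jA (cM.incl z₀) = G.jA (cM.incl z₀)) a = 1)
    (hB₁ : ∀ b ∈ B, FundamentalGroup.mapOfEq (⟨G.jB, G.continuous_jB⟩ : C(cN.W, P))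
      (G.jB_incl_eq_jA_incl z₀) b = 1) :
    SimplyConnectedSpace P := by
  set fA := FundamentalGroup.mapOfEq (⟨G.jA, G.continuous_jA⟩ : C(cM.W, P))
    (rfl : G.jA (cM.incl z₀) = G.jA (cM.incl z₀)) with hfA
  set fB := FundamentalGroup.mapOfEq (⟨G.jB, G.continuous_jB⟩ : C(cN.W, P))
    (G.jB_incl_eq_jA_incl z₀) with hfB
  -- each induced map kills the normal closure of its set, i.e. everything
  have hkA : ∀ a, fA a = 1 := by
    haveI : fA.ker.Normal := MonoidHom.normal_ker fA
    have hle : Subgroup.normalClosure A ≤ fA.ker :=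
      Subgroup.normalClosure_le_normal fun a ha => MonoidHom.mem_ker.2 (hA₁ a ha)
    rw [hA] at hle
    exact fun a => MonoidHom.mem_ker.1 (hle (Subgroup.mem_top a))
  have hB₁' : ∀ b ∈ B, fB b = 1 := hB₁
  have hkB : ∀ b, fB b = 1 := by
    haveI : fB.ker.Normal := MonoidHom.normal_ker fB
    have hle : Subgroup.normalClosure B ≤ fB.ker :=
      Subgroup.normalClosure_le_normal fun b hb => MonoidHom.mem_ker.2 (hB₁' b hb)
    rw [hB] at hle
    exact fun b => MonoidHom.mem_ker.1 (hle (Subgroup.mem_top b))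
  have key : Subgroup.closure (range fA ∪ range fB) ≤ ⊥ := by
    rw [Subgroup.closure_le]
    rintro g (⟨a, rfl⟩ | ⟨b, rfl⟩)
    · rw [hkA a]; exact Subgroup.mem_bot.2 rfl
    · rw [hkB b]; exact Subgroup.mem_bot.2 rfl
  rw [G.closure_range_map_jA_jB_eq_top z₀, top_le_iff] at key
  haveI : Subsingleton (FundamentalGroup P (G.jA (cM.incl z₀))) := by
    refine subsingleton_of_forall_eq 1 fun g => ?_
    have hg : g ∈ (⊥ : Subgroup (FundamentalGroup P (G.jA (cM.incl z₀)))) := by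
      rw [key]; exact Subgroup.mem_top g
    exact Subgroup.mem_bot.1 hg
  -- `P` is path connected (union of the path connected pieces through `x₀`)
  haveI : PathConnectedSpace P := by
    rw [pathConnectedSpace_iff_univ, ← G.range_union]
    exact (isPathConnected_range G.continuous_jA).union (isPathConnected_range G.continuous_jB)
      ⟨G.jA (cM.incl z₀), mem_range_self _, ⟨_, (G.jA_incl z₀).symm⟩⟩
  exact simplyConnectedSpace_of_loops_nullhomotopic_at (G.jA (cM.incl z₀)) fun γ =>
    Path.Homotopic.Quotient.eq.mp
      (Subsingleton.elim (α := FundamentalGroup P (G.jA (cM.incl z₀)))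
        (Path.Homotopic.Quotient.mk γ) (Path.Homotopic.Quotient.mk (Path.refl _)))

include G in
/-- **A gluing of two simply connected compact manifolds along a connected nonempty boundary is
simply connected** (Hatcher 2002, §1.2: van Kampen with both factors trivial). [cite: HatcherAT2002, §1.2, Thm. 1.20 and Lemma 1.15] -/
theorem simplyConnectedSpace [CompactSpace S] [T2Space S] [Nonempty S] [PathConnectedSpace S]
    [CompactSpace S'] [T2Space S'] [Nonempty S'] [PathConnectedSpace S']
    [SimplyConnectedSpace cM.W] [SimplyConnectedSpace cN.W] : SimplyConnectedSpace P := by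
  obtain ⟨z₀⟩ := (inferInstance : Nonempty S)
  refine G.simplyConnectedSpace_of_normalClosure_eq_top z₀ (A := univ) (B := univ) ?_ ?_ ?_ ?_
  · exact top_le_iff.1 fun g _ => Subgroup.subset_normalClosure (mem_univ g)
  · exact top_le_iff.1 fun g _ => Subgroup.subset_normalClosure (mem_univ g)
  · intro a _
    rw [Subsingleton.elim a 1, map_one]
  · intro b _
    rw [Subsingleton.elim b 1, map_one]

end BoundaryGluingData

end Literature.Topology.FourManifolds

end
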